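import Literature.AlgebraicGeometry.HodgeTheory.NodalPencilMonodromyMap
import Literature.AlgebraicGeometry.HodgeTheory.NodalPencilLocalFibre
import Mathlib.Topology.Homotopy.Basic
import Mathlib.Topology.Homeomorph.Lemmas
import HarnessLib

/-!
# The localisation datum of the geometric monodromy of a pencil member near an ordinary double point: the
# inverse time-one map is the identity off the Morse ball and homotopy-conjugate to the antipodal map inside it

Family `hodge`, layer `Literature/AlgebraicGeometry/HodgeTheory`. Written by the prover seat `hodge-nonav-prover-Bx` (g15, cell
`hodge-nonav`) as a brick of the ODP-ISOTOPY port (memo `PROGRAMME-ODP-ISOTOPY-Bx-g13` §2; Picard–Lefschetz binder hPL₁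
`picardLefschetz_oneNode` of crux K1-B, stmt-HodgeConjecture-19716): the analogue, for an ARBITRARY degree `d ≥ 1`, `n + 2`
variables, chart `xᵢ ≠ 0`, monomial pencil direction `xᵢ^d` and an ORDINARY DOUBLE POINT, of prover-Ax's
`CyclicCoverPencilLocalMonodromy` (step A4b for the cyclic pencil), producing exactly the localisation INPUT of the socket
`PicardLefschetzOfPencilIsotopy.exists_isPicardLefschetzData_one_of_pencilIsotopy` (read on the member `X_c` of the pencil inside the
regular locus; the transfer to the projective zero set is the next brick). Fix a member `X_c = pencilFibre n d i b₀ c`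
(`0 < |c| < δ₀`), COMPACT, and let `h₁, k₁ : S → S` be the time-one geometric monodromy map and its inverse
(`NodalPencilMonodromyMap.exists_pencil_monodromyMap` at `u = 1`: `h₁` continuous on `{c ≠ 0}`, `c` and `F` (below `T`) preserved by
both, `h₁ = id` where `F ≥ t₂`, `k₁ ∘ h₁ = id = h₁ ∘ k₁`) with the homotopy `H` from the model monodromy `J(2π, ·)` to `h₁` on the Morse
ball. Then (`exists_localisation_pencilFibre`), with `A = X_c ∩ {F < T'}`, `B = X_c ∩ {F > t₂}` (`t₂ < T' < T`):

* the inverse `κ = k₁|_{X_c}` is a CONTINUOUS self-map of `X_c` (the inverse of the homeomorphism `h₁|_{X_c}` of the compact Hausdorff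
  space `X_c`), the identity on `B`, preserving `A` (restriction `κA`);
* the local Milnor fibre chart `e : A → {Σ zⱼ² = 1}` of `NodalPencilLocalFibre` (injective on every `H_k(·; ℚ)`) conjugates `κA` up to
  homotopy to the ANTIPODAL map `g(z) = −z`: first `e ∘ h₁|_A ≃ g ∘ e` by the homotopy `e ∘ H(s, ·)` (`H(0, ·) = J(2π, ·)` multiplies
  every Morse coordinate by `e^{iπ} = −1`), then `e ∘ κA ≃ g ∘ e` formally from `h₁ ∘ κA = id` and `g ∘ g = id`.

Everything is proved; no definitions, no named facts. Honest scope: plumbing of the classical construction of the geometric monodromy of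
a pencil near an ordinary double point; nothing here says HC or any rung is proved.

## References

* [ArnoldGuseinzadeVarchenko2012] V. I. Arnold, S. M. Gusein-Zade, A. N. Varchenko, Singularities of Differentiable Maps II (2012),
  Part I §1.1, §1.3, §2.1.
* [Milnor1968] J. Milnor, Singular Points of Complex Hypersurfaces, §9 Thm. 9.1, Lemma 9.4.
* [VoisinHodgeII2003] C. Voisin, Hodge Theory and Complex Algebraic Geometry II (2003), §2.3, §3.2.1.
-/

noncomputable section

open CategoryTheory AlgebraicGeometry MvPolynomial TopologicalSpace Set Topology Filter Complex
open scoped Manifold ContDiff Real unitInterval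
open Literature.AlgebraicGeometry.Motives Literature.AlgebraicGeometry.Motives.UniversalHypersurface
open Literature.AlgebraicGeometry.HodgeTheory.UniversalHypersurface Literature.Geometry.ComplexAnalytic Literature.Geometry.Manifold
open Literature.AlgebraicTopology.SingularHomology

namespace Literature.AlgebraicGeometry.HodgeTheory

namespace NodalPencil

/-- **The antipodal map of the `A₁` fibre `{Σ zⱼ² = 1}`.** [cite: ArnoldGuseinzadeVarchenko2012, Part I §1.3] -/
theorem exists_antipodal_fibre_two (n : ℕ) :
    ∃ g : C(↥(PhamBrieskorn.fibre (fun _ : Fin (n + 1) => (2 : ℕ))), ↥(PhamBrieskorn.fibre (fun _ : Fin (n + 1) => (2 : ℕ)))),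
      (∀ z, ((g z : ↥(PhamBrieskorn.fibre (fun _ : Fin (n + 1) => (2 : ℕ)))) : Fin (n + 1) → ℂ) = -(z : Fin (n + 1) → ℂ)) ∧
      g.comp g = ContinuousMap.id _ := by
  have hmem : ∀ z : ↥(PhamBrieskorn.fibre (fun _ : Fin (n + 1) => (2 : ℕ))),
      -(z : Fin (n + 1) → ℂ) ∈ PhamBrieskorn.fibre (fun _ : Fin (n + 1) => (2 : ℕ)) := fun z => by
    have hz := PhamBrieskorn.mem_fibre.mp z.2
    rw [PhamBrieskorn.mem_fibre]
    simpa [neg_sq] using hz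
  refine ⟨⟨fun z => ⟨-(z : Fin (n + 1) → ℂ), hmem z⟩, (continuous_subtype_val.neg).subtype_mk _⟩, fun z => rfl, ?_⟩
  ext z j
  simp

section Localisation

variable {n d : ℕ} {i : Fin (n + 2)} (hd : 0 < d) (b₀ : DegIndex n d → ℂ)
  (Φ : OpenPartialHomeomorph (ComplexPoints (regularTotal ℂ n d)) (({m : DegIndex n d // m ≠ regPowIndex n d i} ⊕ Fin (n + 1)) → ℂ))
  (hΦ : ⇑Φ = regChartFun n d i) (hΦs : Φ.source = regChartDom n d i) (hΦt : Φ.target = regChartFun n d i '' regChartDom n d i)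
  (Θ : OpenPartialHomeomorph (Fin (n + 1) → ℂ) (Fin (n + 1) → ℂ)) {r R''' R'' : ℝ}
  (hr : {z : Fin (n + 1) → ℂ | ∑ j, ‖z j‖ ^ 2 ≤ r ^ 2} ⊆ Θ.target)
  (hΘ : ContDiffOn ℝ ∞ Θ Θ.source) (hR'' : {z : Fin (n + 1) → ℂ | ∑ j, ‖z j‖ ^ 2 ≤ R''} ⊆ Θ.target)
  (φ : (Fin (n + 1) → ℂ) → ℂ)
  (hφ : ∀ y, φ y = regChartCoeffVec n d i
    (Sum.elim (fun m : {m : DegIndex n d // m ≠ regPowIndex n d i} => b₀ m.1) y) (regPowIndex n d i) - b₀ (regPowIndex n d i))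
  (hΘφ : ∀ y ∈ Θ.source, ∑ j, (Θ y j) ^ 2 = φ y)
  {ρW : ℝ}
  (hns : ∀ c : ℂ, c ≠ 0 → ‖c‖ < ρW →
    SmoothHypersurface.IsNonsingularForm ℂ (formOfCoeffs (b₀ + Pi.single (regPowIndex n d i) c)))
  (hR : R''' < R'') {t₂ T' T δ₀ : ℝ} (hTR : T ≤ R''') (hTr : T ≤ r ^ 2) (ht₂T' : t₂ < T') (hT'T : T' < T) (hδρ : δ₀ ≤ ρW)
  -- the time-one monodromy map, its inverse and its homotopy to the model (outputs of `exists_pencil_monodromyMap` at `u = 1`)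
  (h₁ k₁ : pencilSlice n d i b₀ → pencilSlice n d i b₀)
  (hh₁c : Continuous fun x : {x : pencilSlice n d i b₀ // pencilCoord n d i b₀ x.1 ≠ 0} => h₁ x.1)
  (hh₁pc : ∀ x, pencilCoord n d i b₀ x.1 ≠ 0 → ‖pencilCoord n d i b₀ x.1‖ < δ₀ →
    pencilCoord n d i b₀ (h₁ x).1 = pencilCoord n d i b₀ x.1)
  (hh₁F : ∀ x, pencilCoord n d i b₀ x.1 ≠ 0 → ‖pencilCoord n d i b₀ x.1‖ < δ₀ → satRadius n d i Θ R''' R'' x.1 < T →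
    satRadius n d i Θ R''' R'' (h₁ x).1 = satRadius n d i Θ R''' R'' x.1)
  (hh₁id : ∀ x, pencilCoord n d i b₀ x.1 ≠ 0 → ‖pencilCoord n d i b₀ x.1‖ < δ₀ → t₂ ≤ satRadius n d i Θ R''' R'' x.1 → h₁ x = x)
  (hk₁h₁ : ∀ x, pencilCoord n d i b₀ x.1 ≠ 0 → ‖pencilCoord n d i b₀ x.1‖ < δ₀ → k₁ (h₁ x) = x)
  (hh₁k₁ : ∀ x, pencilCoord n d i b₀ x.1 ≠ 0 → ‖pencilCoord n d i b₀ x.1‖ < δ₀ → h₁ (k₁ x) = x)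
  (hk₁pc : ∀ x, pencilCoord n d i b₀ x.1 ≠ 0 → ‖pencilCoord n d i b₀ x.1‖ < δ₀ →
    pencilCoord n d i b₀ (k₁ x).1 = pencilCoord n d i b₀ x.1)
  (H : ℝ × pencilSlice n d i b₀ → pencilSlice n d i b₀)
  (hHc : ContinuousOn H (univ ×ˢ {x : pencilSlice n d i b₀ |
    satRadius n d i Θ R''' R'' x.1 < T ∧ pencilCoord n d i b₀ x.1 ≠ 0 ∧ ‖pencilCoord n d i b₀ x.1‖ < δ₀}))
  (hH : ∀ s x, pencilCoord n d i b₀ x.1 ≠ 0 → ‖pencilCoord n d i b₀ x.1‖ < δ₀ → satRadius n d i Θ R''' R'' x.1 < T →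
    pencilCoord n d i b₀ (H (s, x)).1 = pencilCoord n d i b₀ x.1 ∧
    satRadius n d i Θ R''' R'' (H (s, x)).1 = satRadius n d i Θ R''' R'' x.1 ∧
    (H (0, x)).1 = chartModelIsotopy (fun _ : Fin (n + 1) => 2) Φ Θ (2 * π) x.1 ∧
    (satRadius n d i Θ R''' R'' x.1 ≤ T' → H (1, x) = h₁ x))
  -- the member
  {c : ℂ} (hc0 : c ≠ 0) (hcδ : ‖c‖ < δ₀) (hXc : IsCompact (pencilFibre n d i b₀ c))
  (lam : Fin (n + 1) → ℂ) (hlam : ∀ j, lam j ^ 2 = c) (hlamT : ∑ j, ‖lam j‖ ^ 2 < T')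
include hd hΦ hΦs hΦt hr hΘ hR'' hφ hΘφ hns hR hTR hTr ht₂T' hT'T hδρ hh₁c hh₁pc hh₁F hh₁id hk₁h₁ hh₁k₁ hk₁pc hHc hH hc0 hcδ hXc
  hlam hlamT

/-- **The localisation datum on the member `X_c`.** With `A = X_c ∩ {F < T'}`: a continuous self-map `κ` of `X_c` reading the
inverse time-one monodromy map `k₁`, equal to the identity where `F > t₂` and preserving `A` (restriction `κA`); the local Milnor
fibre chart `e : A → {Σ zⱼ² = 1}`, injective on every `H_k(·; ℚ)`; the antipodal map `g`; and the homotopy `e ∘ κA ≃ g ∘ e`.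
[cite: ArnoldGuseinzadeVarchenko2012, Part I §1.3 and §2.1] [cite: Milnor1968, §9 Thm. 9.1 and Lemma 9.4]
[cite: VoisinHodgeII2003, §3.2.1] -/
theorem exists_localisation_pencilFibre :
    ∃ (κ : C(↥(pencilFibre n d i b₀ c), ↥(pencilFibre n d i b₀ c)))
      (κA : C(↥{Q : ↥(pencilFibre n d i b₀ c) | satRadius n d i Θ R''' R'' Q.1 < T'},
        ↥{Q : ↥(pencilFibre n d i b₀ c) | satRadius n d i Θ R''' R'' Q.1 < T'}))
      (e : C(↥{Q : ↥(pencilFibre n d i b₀ c) | satRadius n d i Θ R''' R'' Q.1 < T'},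
        ↥(PhamBrieskorn.fibre (fun _ : Fin (n + 1) => (2 : ℕ)))))
      (g : C(↥(PhamBrieskorn.fibre (fun _ : Fin (n + 1) => (2 : ℕ))), ↥(PhamBrieskorn.fibre (fun _ : Fin (n + 1) => (2 : ℕ))))),
      (∀ y, ((κ y : ↥(pencilFibre n d i b₀ c)) : ComplexPoints (regularTotal ℂ n d)) = (k₁ ⟨y.1, y.2.1⟩).1) ∧
      (∀ y : ↥(pencilFibre n d i b₀ c), t₂ < satRadius n d i Θ R''' R'' y.1 → κ y = y) ∧
      (∀ a, ((κA a : ↥{Q : ↥(pencilFibre n d i b₀ c) | satRadius n d i Θ R''' R'' Q.1 < T'}) : ↥(pencilFibre n d i b₀ c)) =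
        κ a.1) ∧
      (∀ k', Function.Injective (singularHomology.map ℚ ℚ e k').hom) ∧
      (∀ z, ((g z : ↥(PhamBrieskorn.fibre (fun _ : Fin (n + 1) => (2 : ℕ)))) : Fin (n + 1) → ℂ) = -(z : Fin (n + 1) → ℂ)) ∧
      (e.comp κA).Homotopic (g.comp e) := by
  haveI : T2Space (ComplexPoints (regularTotal ℂ n d)) := t2Space_regularTotal n d
  haveI : CompactSpace ↥(pencilFibre n d i b₀ c) := isCompact_iff_compactSpace.mp hXc
  have hcρ : ‖c‖ < ρW := lt_of_lt_of_le hcδ hδρ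
  have hT'R : T' ≤ R''' := hT'T.le.trans hTR
  have hT'r : T' ≤ r ^ 2 := hT'T.le.trans hTr
  set X := pencilFibre n d i b₀ c with hX_def
  -- points of `X_c` as good points of the slice
  have hgoodc : ∀ y : ↥X, pencilCoord n d i b₀ y.1 ≠ 0 ∧ ‖pencilCoord n d i b₀ y.1‖ < δ₀ := fun y => by
    rw [y.2.2]; exact ⟨hc0, hcδ⟩
  -- the restriction `hY` of `h₁` to `X_c`, a homeomorphism with inverse reading `k₁`
  let toS : ↥X → {x : pencilSlice n d i b₀ // pencilCoord n d i b₀ x.1 ≠ 0} := fun y => ⟨⟨y.1, y.2.1⟩, (hgoodc y).1⟩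
  have htoS : Continuous toS := (continuous_subtype_val.subtype_mk _).subtype_mk _
  have hmemY : ∀ y : ↥X, (h₁ ⟨y.1, y.2.1⟩).1 ∈ X := fun y =>
    ⟨(h₁ ⟨y.1, y.2.1⟩).2, by rw [hh₁pc ⟨y.1, y.2.1⟩ (hgoodc y).1 (hgoodc y).2]; exact y.2.2⟩
  have hmemK : ∀ y : ↥X, (k₁ ⟨y.1, y.2.1⟩).1 ∈ X := fun y =>
    ⟨(k₁ ⟨y.1, y.2.1⟩).2, by rw [hk₁pc ⟨y.1, y.2.1⟩ (hgoodc y).1 (hgoodc y).2]; exact y.2.2⟩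
  let hY : C(↥X, ↥X) := ⟨fun y => ⟨(h₁ ⟨y.1, y.2.1⟩).1, hmemY y⟩, (continuous_subtype_val.comp (hh₁c.comp htoS)).subtype_mk _⟩
  have hYval : ∀ y, ((hY y : ↥X) : ComplexPoints (regularTotal ℂ n d)) = (h₁ ⟨y.1, y.2.1⟩).1 := fun y => rfl
  let kY : ↥X → ↥X := fun y => ⟨(k₁ ⟨y.1, y.2.1⟩).1, hmemK y⟩
  have hkYval : ∀ y, ((kY y : ↥X) : ComplexPoints (regularTotal ℂ n d)) = (k₁ ⟨y.1, y.2.1⟩).1 := fun y => rfl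
  have hkh : ∀ y, kY (hY y) = y := fun y => by
    apply Subtype.ext
    rw [hkYval]
    have h := hk₁h₁ ⟨y.1, y.2.1⟩ (hgoodc y).1 (hgoodc y).2
    have hmk : (⟨(hY y).1, (hY y).2.1⟩ : pencilSlice n d i b₀) = h₁ ⟨y.1, y.2.1⟩ := Subtype.ext (hYval y)
    rw [hmk, h]
  have hhk : ∀ y, hY (kY y) = y := fun y => by
    apply Subtype.ext
    rw [hYval]
    have h := hh₁k₁ ⟨y.1, y.2.1⟩ (hgoodc y).1 (hgoodc y).2
    have hmk : (⟨(kY y).1, (kY y).2.1⟩ : pencilSlice n d i b₀) = k₁ ⟨y.1, y.2.1⟩ := Subtype.ext (hkYval y)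
    rw [hmk, h]
  let hYe : ↥X ≃ ↥X := ⟨hY, kY, hkh, hhk⟩
  let hYh : ↥X ≃ₜ ↥X := Continuous.homeoOfEquivCompactToT2 (f := hYe) hY.continuous
  let κ : C(↥X, ↥X) := (hYh.symm : C(↥X, ↥X))
  have hκ : ∀ y, κ y = kY y := fun y => rfl
  -- the open cover `A = {F < T'}`, `B = {F > t₂}`
  have hFc : Continuous (satRadius n d i Θ R''' R'') := continuous_satRadius n d i Θ R''' R'' hd hΘ hR hR''
  set A : Set ↥X := {Q | satRadius n d i Θ R''' R'' Q.1 < T'} with hA_def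
  have hB : ∀ y : ↥X, t₂ < satRadius n d i Θ R''' R'' y.1 → κ y = y := fun y hy => by
    have h1 : hY y = y := Subtype.ext (by rw [hYval, hh₁id ⟨y.1, y.2.1⟩ (hgoodc y).1 (hgoodc y).2 (le_of_lt hy)])
    calc κ y = κ (hY y) := by rw [h1]
      _ = y := by rw [hκ]; exact hkh y
  have hAF : ∀ y : ↥A, satRadius n d i Θ R''' R'' (hY y.1).1 < T' := fun y => by
    rw [hYval, hh₁F ⟨y.1.1, y.1.2.1⟩ (hgoodc y.1).1 (hgoodc y.1).2 (lt_trans y.2 hT'T)]; exact y.2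
  have hAK : ∀ y : ↥A, satRadius n d i Θ R''' R'' (κ y.1).1 < T' := fun y => by
    -- `F(k₁ y) = F(y)` since `F(y) < T` and `y = h₁ (k₁ y)`
    rw [hκ, hkYval]
    have hyT : satRadius n d i Θ R''' R'' y.1.1 < T := lt_trans y.2 hT'T
    -- apply `hh₁F` to `k₁ y`: need `F(k₁ y) < T`; argue by contradiction using `hh₁id`
    by_contra hnot
    have hge : T' ≤ satRadius n d i Θ R''' R'' (k₁ ⟨y.1.1, y.1.2.1⟩).1 := not_lt.mp hnot
    have hk0 : pencilCoord n d i b₀ (k₁ ⟨y.1.1, y.1.2.1⟩).1 ≠ 0 := by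
      rw [hk₁pc ⟨y.1.1, y.1.2.1⟩ (hgoodc y.1).1 (hgoodc y.1).2]; exact (hgoodc y.1).1
    have hkδ : ‖pencilCoord n d i b₀ (k₁ ⟨y.1.1, y.1.2.1⟩).1‖ < δ₀ := by
      rw [hk₁pc ⟨y.1.1, y.1.2.1⟩ (hgoodc y.1).1 (hgoodc y.1).2]; exact (hgoodc y.1).2
    have hid := hh₁id (k₁ ⟨y.1.1, y.1.2.1⟩) hk0 hkδ (ht₂T'.le.trans hge)
    rw [hh₁k₁ ⟨y.1.1, y.1.2.1⟩ (hgoodc y.1).1 (hgoodc y.1).2] at hid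
    have hF : satRadius n d i Θ R''' R'' y.1.1 = satRadius n d i Θ R''' R'' (k₁ ⟨y.1.1, y.1.2.1⟩).1 := by
      rw [← hid]
    exact absurd (hF ▸ y.2) hnot
  let hA : C(↥A, ↥A) := ⟨fun y => ⟨hY y.1, hAF y⟩, (hY.continuous.comp continuous_subtype_val).subtype_mk _⟩
  let κA : C(↥A, ↥A) := ⟨fun y => ⟨κ y.1, hAK y⟩, (κ.continuous.comp continuous_subtype_val).subtype_mk _⟩
  have hhAκA : hA.comp κA = ContinuousMap.id _ := by
    refine ContinuousMap.ext fun y => Subtype.ext ?_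
    change hY (κ y.1) = y.1
    rw [hκ, hhk]
  -- the local Milnor fibre chart
  obtain ⟨e, hinj, he⟩ := exists_localFibreChart hd b₀ Φ hΦ hΦs hΦt Θ hr φ hφ hΘφ hns hR hT'R hT'r hc0 hcρ lam hlam
    hΘ.continuousOn hlamT
  -- the antipodal map
  obtain ⟨g, hg, hgg⟩ := exists_antipodal_fibre_two n
  -- the homotopy `e ∘ H(s, ·)` on `A`
  have hD : ∀ y : ↥A, satRadius n d i Θ R''' R'' y.1.1 < T ∧ pencilCoord n d i b₀ y.1.1 ≠ 0 ∧
      ‖pencilCoord n d i b₀ y.1.1‖ < δ₀ := fun y =>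
    ⟨lt_trans y.2 hT'T, (hgoodc y.1).1, (hgoodc y.1).2⟩
  have hHmem : ∀ (s : ℝ) (y : ↥A), (H (s, ⟨y.1.1, y.1.2.1⟩)).1 ∈ X ∧
      satRadius n d i Θ R''' R'' (H (s, ⟨y.1.1, y.1.2.1⟩)).1 < T' := fun s y => by
    obtain ⟨hpc, hF, -, -⟩ := hH s ⟨y.1.1, y.1.2.1⟩ (hD y).2.1 (hD y).2.2 (hD y).1
    exact ⟨⟨(H (s, ⟨y.1.1, y.1.2.1⟩)).2, by rw [hpc]; exact y.1.2.2⟩, by rw [hF]; exact y.2⟩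
  let pt : ℝ × ↥A → ↥A := fun sy => ⟨⟨(H (sy.1, ⟨sy.2.1.1, sy.2.1.2.1⟩)).1, (hHmem sy.1 sy.2).1⟩, (hHmem sy.1 sy.2).2⟩
  have hptc : Continuous pt := by
    refine Continuous.subtype_mk (Continuous.subtype_mk ?_ _) _
    have hin : Continuous fun sy : ℝ × ↥A => ((sy.1, ⟨sy.2.1.1, sy.2.1.2.1⟩) : ℝ × pencilSlice n d i b₀) :=
      continuous_fst.prodMk ((continuous_subtype_val.comp (continuous_subtype_val.comp continuous_snd)).subtype_mk _)
    exact continuous_subtype_val.comp (hHc.comp_continuous hin fun sy => ⟨mem_univ _, hD sy.2⟩)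
  let G : C(I × ↥A, ↥(PhamBrieskorn.fibre (fun _ : Fin (n + 1) => (2 : ℕ)))) :=
    ⟨fun sy => e (pt (sy.1, sy.2)), e.continuous.comp (hptc.comp ((continuous_subtype_val.comp continuous_fst).prodMk continuous_snd))⟩
  -- `G(0, ·) = g ∘ e`
  have hG0 : ∀ y : ↥A, G (0, y) = g (e y) := by
    intro y
    obtain ⟨-, -, hH0, -⟩ := hH 0 ⟨y.1.1, y.1.2.1⟩ (hD y).2.1 (hD y).2.2 (hD y).1
    obtain ⟨hx, hyΘ, hyr, -⟩ := monodromyMap_good hd b₀ Φ hΦ hΦs hΦt Θ hr φ hφ hΘφ hns hR hTR hTr y.1.2.1 (hD y).1 (hD y).2.1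
      (lt_of_lt_of_le (hD y).2.2 hδρ)
    have haff := affine_chartModelIsotopy hd b₀ Φ hΦ hΦs hΦt Θ hr φ hφ hΘφ hns hx y.1.2.1 hyΘ hyr (hD y).2.1
      (lt_of_lt_of_le (hD y).2.2 hδρ) (2 * π)
    obtain ⟨-, happ, -⟩ := PhamBrieskorn.modelIsotopy_mem (fun _ : Fin (n + 1) => 2) Θ hr hyr (2 * π)
    apply Subtype.ext
    change (e (pt ((0 : I), y)) : Fin (n + 1) → ℂ) = (g (e y) : Fin (n + 1) → ℂ)
    rw [he, hg, he]
    change (fun j => Θ (fun j => regChartFun n d i (H ((0 : ℝ), ⟨y.1.1, y.1.2.1⟩)).1 (Sum.inr j)) j / lam j) = _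
    rw [hH0, haff]
    rw [happ]
    have hπ : Complex.exp ((((2 * π) / (2 : ℕ) : ℝ) : ℂ) * Complex.I) = -1 := by
      rw [show (((2 * π) / (2 : ℕ) : ℝ) : ℂ) * Complex.I = π * Complex.I by push_cast; ring, Complex.exp_pi_mul_I]
    funext j
    simp only [hπ, Pi.neg_apply, neg_one_mul, neg_div]
  -- `G(1, ·) = e ∘ hA`
  have hG1 : ∀ y : ↥A, G (1, y) = e (hA y) := by
    intro y
    obtain ⟨-, -, -, hH1⟩ := hH 1 ⟨y.1.1, y.1.2.1⟩ (hD y).2.1 (hD y).2.2 (hD y).1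
    change e (pt ((1 : ℝ), y)) = e (hA y)
    congr 1
    apply Subtype.ext; apply Subtype.ext
    change (H ((1 : ℝ), ⟨y.1.1, y.1.2.1⟩)).1 = (h₁ ⟨y.1.1, y.1.2.1⟩).1
    rw [hH1 (le_of_lt y.2)]
  have hconj₁ : (e.comp hA).Homotopic (g.comp e) :=
    ⟨{ toContinuousMap := G
       map_zero_left := fun y => by rw [ContinuousMap.comp_apply]; exact hG0 y
       map_one_left := fun y => by rw [ContinuousMap.comp_apply]; exact hG1 y :
        ContinuousMap.Homotopy (g.comp e) (e.comp hA) }.symm⟩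
  -- transfer to the inverse: `e ∘ κA ≃ g ∘ e`
  have hconj : (e.comp κA).Homotopic (g.comp e) := by
    -- `e = (e ∘ hA) ∘ κA ≃ (g ∘ e) ∘ κA`, then apply `g`: `g ∘ e ≃ g ∘ g ∘ e ∘ κA = e ∘ κA`
    have h2 : ((e.comp hA).comp κA).Homotopic ((g.comp e).comp κA) := hconj₁.comp (ContinuousMap.Homotopic.refl κA)
    have he' : (e.comp hA).comp κA = e := by rw [ContinuousMap.comp_assoc, hhAκA, ContinuousMap.comp_id]
    rw [he'] at h2
    have h3 : (g.comp e).Homotopic (g.comp ((g.comp e).comp κA)) := (ContinuousMap.Homotopic.refl g).comp h2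
    have hgg' : g.comp ((g.comp e).comp κA) = e.comp κA := by
      rw [ContinuousMap.comp_assoc, ← ContinuousMap.comp_assoc g g, hgg, ContinuousMap.id_comp]
    rw [hgg'] at h3
    exact h3.symm
  refine ⟨κ, κA, e, g, fun y => by rw [hκ], hB, fun a => rfl, hinj, hg, hconj⟩

end Localisation

end NodalPencil

end Literature.AlgebraicGeometry.HodgeTheory

end
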